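import Summits.AtomisticToContinuum.BoseEinsteinCondensation.Theorems.BECGroundStateSOSPeriodicIRBoundDefs
import Summits.AtomisticToContinuum.BoseEinsteinCondensation.Theorems.BECGroundStateSOSPeriodicIRBoundWFDefs
import Literature.MathematicalPhysics.QuantumManyBody.PeriodicBoseGasMomentumSector
import Literature.MathematicalPhysics.QuantumManyBody.PeriodicConfigFourier
import Literature.MathematicalPhysics.QuantumManyBody.PeriodicBoseGasEq317
import Literature.MathematicalPhysics.QuantumManyBody.PeriodicBoseGasLemma33
import Literature.MathematicalPhysics.QuantumManyBody.PeriodicBoseGasImpurityTranslation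
import Literature.MathematicalPhysics.QuantumManyBody.PeriodicCondensateCoherence
import Literature.MathematicalPhysics.QuantumManyBody.CoarseModeRayPOVMFormCore
import HarnessLib

/-! # Crux `PeriodicIRBound` (stmt-AtomisticToContinuum-3972), line `linear-ph-floor-wagner`, stub 5b `stub_wagnerFeynman` — ComFourier
E1 (part 1): the centre-of-mass Fourier components `Ψ_q`: regularity, periodicity, symmetry, total momentum `2πq/L`, `Ψ_0 = PΨ`, linearity. -/

/-!

For an `M`-body function `Ψ` on the torus of side `L`, the centre-of-mass Fourier components
`Ψ_q(X) = L⁻³ ∫_{[0,L)³} e^{-2πi q·s/L} Ψ(X + s·𝟙) ds` (`comCoeff`, the cell Fourier coefficients of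
the slice `s ↦ Ψ(X + s·𝟙)`), `q ∈ ℤ³`. This part: `Ψ_0 = PΨ` is the translation average (`comProj`,
E1b), linearity `(Ψ - Φ)_q = Ψ_q - Φ_q` (E1f), a function of total momentum `2πq'/L` has the single
component `q'` (E1g, orthogonality of the plane waves), and regularity: `Ψ_q` is `C¹`, periodic in
every particle, Bose-symmetric and of total momentum `2πq/L` when `Ψ` is a core function (E1a, E1;
the `C¹` part is one derivative under the integral sign over the bounded cell, the momentum part is
the translate rule `ĉ_q(φ(· + t)) = e_q(t) ĉ_q(φ)`). Parseval for the three quadratic forms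
(E1c–E1e) is in `WFComFourier2.lean`.
-/

noncomputable section

open scoped BigOperators ENNReal ComplexConjugate
open Filter MeasureTheory

namespace Summit.AtomisticToContinuum.BoseEinsteinCondensation.Cruxes.PeriodicIRBound.LinearPhFloorWagner.WF

open Literature.MathematicalPhysics.QuantumManyBody.BoseGas

variable {M : ℕ} {L : ℝ}

-- `comCoeff` is the §E definition of WFPlan.lean (verbatim); it is NOT part of the Defs module's §2b
-- vocabulary, so it stays here when the block above is replaced by the import.

/-! ### The slices `s ↦ Ψ(X + s·𝟙)` -/

/-- The slice `s ↦ Ψ(X + s·𝟙)` of a continuous function is continuous. [folklore] -/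
theorem continuous_comSlice {Ψ : Config M → ℂ} (hΨ : Continuous Ψ) (X : Config M) :
    Continuous fun s : Space => Ψ (fun i => X i + s) :=
  hΨ.comp (continuous_pi fun _ => continuous_const.add continuous_id)

/-- The slice `s ↦ Ψ(X + s·𝟙)` of a function that is `Lℤ³`-periodic in every particle is
`Lℤ³`-periodic. [folklore] -/
theorem comSlice_periodic {Ψ : Config M → ℂ} (hper : IsTorusPeriodic L Ψ) (X : Config M) :
    ∀ (s : Space) (k : Fin 3),
      Ψ (fun i => X i + (s + EuclideanSpace.single k L)) = Ψ (fun i => X i + s) := by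
  intro s k
  have h : (fun i => X i + (s + EuclideanSpace.single k L)) =
      (fun i => X i + s) + latticeVecN L (fun _ : Fin M => Pi.single k (1 : ℤ)) := by
    funext i
    simp only [Pi.add_apply, latticeVecN, latticeVec_single, add_assoc]
  rw [h, hper.add_latticeVecN]

/-! ### Plane-wave phases and the translate rule -/

/-- The Bloch character of the dual-lattice momentum `2πq/L` is the plane wave `e_q`:
`exp(i (2πq/L)·s) = e_q(s)`. [folklore] -/
theorem exp_latticeVec_eq_cellWave (L : ℝ) (q : Fin 3 → ℤ) (s : Space) :
    Complex.exp (Complex.I * ↑(∑ j, (latticeVec (2 * Real.pi / L) q) j * s j)) = cellWave L q s := by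
  rw [cellWave_apply]
  congr 1
  have h2 : (∑ k, (latticeVec (2 * Real.pi / L) q) k * s k) =
      2 * Real.pi / L * ∑ k, (q k : ℝ) * s k := by
    rw [Finset.mul_sum]
    exact Finset.sum_congr rfl fun k _ => by simp only [latticeVec, PiLp.toLp_apply]; ring
  rw [h2]
  push_cast
  ring

/-- **Fourier coefficients of a translate**: `ĉ_q(φ(· + t)) = e_q(t) ĉ_q(φ)` for an `Lℤ³`-periodic
`φ` (shift invariance of the cell integral of the periodic `e_{-q} φ`). [folklore] -/
theorem cellFourierCoeff_comp_add (hL : 0 < L) {φ : Space → ℂ}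
    (hφ : ∀ (x : Space) (k : Fin 3), φ (x + EuclideanSpace.single k L) = φ x) (t : Space)
    (q : Fin 3 → ℤ) :
    cellFourierCoeff L (fun s => φ (s + t)) q = cellWave L q t * cellFourierCoeff L φ q := by
  rw [cellFourierCoeff_eq_integral hL, cellFourierCoeff_eq_integral hL, Complex.real_smul,
    Complex.real_smul]
  simp only [conj_cellWave]
  have hH : ∀ (x : Space) (k : Fin 3),
      (fun y => cellWave L (-q) y * φ y) (x + EuclideanSpace.single k L) =
        (fun y => cellWave L (-q) y * φ y) x := fun x k => by
    simp only [cellWave_periodic hL.ne', hφ]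
  have hshift := setIntegral_cell_comp_add_of_periodic hL (H := fun y => cellWave L (-q) y * φ y) hH t
  have h1 : cellWave L q t * cellWave L (-q) t = 1 := by
    rw [← cellWave_add_index, add_neg_cancel, cellWave_zero]
  have hpt : ∀ x : Space, cellWave L (-q) x * φ (x + t) =
      cellWave L q t * (cellWave L (-q) (x + t) * φ (x + t)) := by
    intro x
    rw [cellWave_add L (-q) x t]
    calc cellWave L (-q) x * φ (x + t)
        = (cellWave L q t * cellWave L (-q) t) * (cellWave L (-q) x * φ (x + t)) := by
          rw [h1, one_mul]
      _ = cellWave L q t * (cellWave L (-q) x * cellWave L (-q) t * φ (x + t)) := by ring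
  rw [setIntegral_congr_fun (measurableSet_cell L) (fun x _ => hpt x), integral_const_mul, hshift]
  ring

/-- The centre-of-mass coefficient as a cell integral:
`Ψ_q(X) = L⁻³ ∫_{[0,L)³} e_{-q}(s) Ψ(X + s·𝟙) ds`. [folklore] -/
theorem comCoeff_eq_integral (hL : 0 < L) (Ψ : Config M → ℂ) (q : Fin 3 → ℤ) (X : Config M) :
    comCoeff L Ψ q X =
      (((L ^ 3)⁻¹ : ℝ) : ℂ) * ∫ s in cell L, cellWave L (-q) s * Ψ (fun i => X i + s) := by
  rw [comCoeff, cellFourierCoeff_eq_integral hL, Complex.real_smul]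
  simp only [conj_cellWave]

/-- Constants come out of the cell Fourier coefficients: `ĉ_q(c φ) = c ĉ_q(φ)`. [folklore] -/
theorem cellFourierCoeff_const_mul_left (hL : 0 < L) (c : ℂ) (φ : Space → ℂ) (q : Fin 3 → ℤ) :
    cellFourierCoeff L (fun x => c * φ x) q = c * cellFourierCoeff L φ q := by
  rw [cellFourierCoeff_eq_integral hL, cellFourierCoeff_eq_integral hL, Complex.real_smul,
    Complex.real_smul]
  have h : ∀ x, conj (cellWave L q x) * (c * φ x) = c * (conj (cellWave L q x) * φ x) :=
    fun x => by ring
  simp_rw [h, integral_const_mul]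
  ring

/-! ### E1f, E1b, E1g -/

/-- E1f (linearity): `(Ψ - Φ)_q = Ψ_q - Φ_q` for continuous `Ψ, Φ`. -/
theorem comCoeff_sub (hL : 0 < L) {Ψ Φ : Config M → ℂ} (hΨ : Continuous Ψ) (hΦ : Continuous Φ) (q : Fin 3 → ℤ) :
    comCoeff L (fun X => Ψ X - Φ X) q = fun X => comCoeff L Ψ q X - comCoeff L Φ q X := by
  funext X
  simp only [comCoeff_eq_integral hL]
  rw [← mul_sub, ← integral_sub
    (integrableOn_cell (f := fun s => cellWave L (-q) s * Ψ (fun i => X i + s))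
      ((continuous_cellWave L (-q)).mul (continuous_comSlice hΨ X)))
    (integrableOn_cell (f := fun s => cellWave L (-q) s * Φ (fun i => X i + s))
      ((continuous_cellWave L (-q)).mul (continuous_comSlice hΦ X)))]
  congr 1
  refine setIntegral_congr_fun (measurableSet_cell L) fun s _ => ?_
  simp only [mul_sub]

/-- E1b: `Ψ_0 = PΨ`. -/
theorem comCoeff_zero (hL : 0 < L) {Ψ : Config M → ℂ} (hΨ : Continuous Ψ) : comCoeff L Ψ 0 = comProj L Ψ := by
  have _hΨ := hΨ -- (continuity is part of the planned statement but not needed here)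
  funext X
  rw [comCoeff, cellFourierCoeff_zero hL, Complex.real_smul]
  rfl

/-- E1g (a definite-momentum function has a single coefficient): if `f` has total momentum `2πq'/L` then
`f_q = [q = q'] f`. -/
theorem comCoeff_of_hasTotalMomentum (hL : 0 < L) {f : Config M → ℂ} (hf : Continuous f) {q' : Fin 3 → ℤ}
    (hq' : HasTotalMomentum (latticeVec (2 * Real.pi / L) q') f) (q : Fin 3 → ℤ) :
    comCoeff L f q = if q = q' then f else 0 := by
  have _hf := hf -- (continuity is part of the planned statement but not needed here)
  have key : ∀ X, comCoeff L f q X = (if q = q' then 1 else 0) * f X := by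
    intro X
    have hslice : (fun s : Space => f (fun i => X i + s)) = fun s => f X * cellWave L q' s := by
      funext s
      rw [hq' s X, exp_latticeVec_eq_cellWave, mul_comm]
    rw [comCoeff, hslice, cellFourierCoeff_const_mul_left hL, cellFourierCoeff_cellWave hL q' q,
      mul_comm]
  funext X
  by_cases h : q = q'
  · rw [key, if_pos h, if_pos h, one_mul]
  · rw [key, if_neg h, if_neg h, zero_mul, Pi.zero_apply]

/-! ### Regularity of the components: E1a, E1 -/

/-- `Ψ_q` is `Lℤ³`-periodic in every particle when `Ψ` is (the slice through `X + L e_{i,k}` is the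
slice through `X`). [folklore] -/
theorem comCoeff_periodic {Ψ : Config M → ℂ} (hper : IsTorusPeriodic L Ψ) (q : Fin 3 → ℤ) :
    IsTorusPeriodic L (comCoeff L Ψ q) := by
  intro X i k
  show cellFourierCoeff L
      (fun s => Ψ (fun j => (X + Pi.single i (EuclideanSpace.single k L) : Config M) j + s)) q =
    cellFourierCoeff L (fun s => Ψ (fun j => X j + s)) q
  congr 1
  funext s
  have h : (fun j => (X + Pi.single i (EuclideanSpace.single k L) : Config M) j + s) =
      (fun j => X j + s) + Pi.single i (EuclideanSpace.single k L) := by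
    funext j
    simp only [Pi.add_apply]
    exact add_right_comm _ _ _
  rw [h, hper]

/-- `Ψ_q` is Bose-symmetric when `Ψ` is. [folklore] -/
theorem comCoeff_symm {Ψ : Config M → ℂ} (hsymm : IsSymm Ψ) (q : Fin 3 → ℤ) : IsSymm (comCoeff L Ψ q) := by
  intro σ X
  show cellFourierCoeff L (fun s => Ψ (fun j => (X ∘ σ) j + s)) q =
    cellFourierCoeff L (fun s => Ψ (fun j => X j + s)) q
  congr 1
  funext s
  exact hsymm σ (fun j => X j + s)

/-- **`Ψ_q` has total momentum `2πq/L`**: translating all particles by `t` translates the slice,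
`(Ψ_q)(X + t·𝟙) = ĉ_q(s ↦ Ψ(X + (s + t)·𝟙)) = e_q(t) Ψ_q(X)` (`cellFourierCoeff_comp_add`). [folklore] -/
theorem hasTotalMomentum_comCoeff (hL : 0 < L) {Ψ : Config M → ℂ} (hper : IsTorusPeriodic L Ψ)
    (q : Fin 3 → ℤ) : HasTotalMomentum (latticeVec (2 * Real.pi / L) q) (comCoeff L Ψ q) := by
  intro t X
  rw [exp_latticeVec_eq_cellWave]
  show cellFourierCoeff L (fun s => Ψ (fun i => X i + t + s)) q =
    cellWave L q t * cellFourierCoeff L (fun s => Ψ (fun i => X i + s)) q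
  have h : (fun s => Ψ (fun i => X i + t + s)) = fun s => (fun s => Ψ (fun i => X i + s)) (s + t) := by
    funext s
    simp only [add_assoc, add_comm t s]
  rw [h, cellFourierCoeff_comp_add hL (φ := fun s => Ψ (fun i => X i + s)) (comSlice_periodic hper X) t q]

/-- The integrand `(s, X) ↦ e_{-q}(s) Ψ(X + s·𝟙)` of `Ψ_q` is `C¹` when `Ψ` is. [folklore] -/
theorem contDiff_comIntegrand {Ψ : Config M → ℂ} (hΨ : ContDiff ℝ 1 Ψ) (q : Fin 3 → ℤ) :
    ContDiff ℝ 1 fun p : Space × Config M => cellWave L (-q) p.1 * Ψ (fun i => p.2 i + p.1) := by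
  have hA : ContDiff ℝ 1 fun p : Space × Config M => (fun i => p.2 i + p.1 : Config M) :=
    contDiff_pi.2 fun i => ((contDiff_apply ℝ Space i).comp contDiff_snd).add contDiff_fst
  exact (((contDiff_cellWave L (-q)).of_le (mod_cast le_top)).comp contDiff_fst).mul (hΨ.comp hA)

/-- **`Ψ_q` is `C¹` when `Ψ` is**: a parametric integral of a `C¹` integrand over the bounded cell
(one derivative under the integral sign, `contDiff_one_parametric_setIntegral_of_isBounded`). [folklore] -/
theorem contDiff_comCoeff (hL : 0 < L) {Ψ : Config M → ℂ} (hΨ : ContDiff ℝ 1 Ψ) (q : Fin 3 → ℤ) :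
    ContDiff ℝ 1 (comCoeff L Ψ q) := by
  have h := contDiff_one_parametric_setIntegral_of_isBounded (μ := (volume : Measure Space))
    (isBounded_cell L) (measurableSet_cell L) (contDiff_comIntegrand (L := L) hΨ q)
  have heq : comCoeff L Ψ q = fun X => (((L ^ 3)⁻¹ : ℝ) : ℂ) *
      ∫ s in cell L, cellWave L (-q) s * Ψ (fun i => X i + s) :=
    funext fun X => comCoeff_eq_integral hL Ψ q X
  rw [heq]
  exact contDiff_const.mul h

/-- E1a: each `Ψ_q` is a core function of total momentum `2πq/L`. -/
theorem isCore_comCoeff (hL : 0 < L) {Ψ : Config M → ℂ} (hΨ : IsCore L Ψ) (q : Fin 3 → ℤ) :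
    IsCore L (comCoeff L Ψ q) ∧ HasTotalMomentum (latticeVec (2 * Real.pi / L) q) (comCoeff L Ψ q) :=
  ⟨⟨contDiff_comCoeff hL hΨ.contDiff q, comCoeff_periodic hΨ.periodic q, comCoeff_symm hΨ.symm q⟩,
    hasTotalMomentum_comCoeff hL hΨ.periodic q⟩

/-- E1: `PΨ` is a core function of total momentum `0` when `Ψ` is a core function. -/
theorem isCore_comProj (hL : 0 < L) {Ψ : Config M → ℂ} (hΨ : IsCore L Ψ) :
    IsCore L (comProj L Ψ) ∧ HasTotalMomentum 0 (comProj L Ψ) := by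
  rw [← comCoeff_zero hL hΨ.contDiff.continuous]
  have h := isCore_comCoeff hL hΨ 0
  rwa [latticeVec_zero] at h

end Summit.AtomisticToContinuum.BoseEinsteinCondensation.Cruxes.PeriodicIRBound.LinearPhFloorWagner.WF

end

namespace Summit.AtomisticToContinuum.BoseEinsteinCondensation.Cruxes.PeriodicIRBound.LinearPhFloorWagner

/-- The registered sub-goal `stub_wfComFourier` of the crux ledger: this file's headline lemma `WF.isCore_comProj`. -/
theorem stub_wfComFourier : WF.Pkg.ComFourier :=
  @WF.isCore_comProj

end Summit.AtomisticToContinuum.BoseEinsteinCondensation.Cruxes.PeriodicIRBound.LinearPhFloorWagner
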